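import Mathlib
import HarnessLib
import Summits.HubbardSuperconductivity.HubbardSuperconductivity.Theorems.KLProgrammeKLRegimeFatMultiplierIncrementLine

/-!
# Route `KLProgramme` — crux K3 ENGINE (stmt-HubbardSuperconductivity-20437), stub (b) conj. 2 «(c-D)² FAMILY TELESCOPE», brick (L2) of F1-DESIGN §9 «ANISO-LOC»:
# the derivative chain of the radial-profile increment along a grid line with band data LOCALISED to a set `S` of line parameters

Cell `gate-hubbard-kl`, seat hubbard-kl-k3c3-p2 (g10).  Twin of `…FatMultiplierIncrementLineChain.profileIncr_hasDerivAt_chain_bounds` (p580399) in which the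
band's line jets are assumed only ON `S` (`∀ t, S t → |e_k t| ≤ E_k`; the piece's jets stay global) and the pointwise bounds `‖I_k(s)‖ ≤ 𝔅_k`, `k ≥ 1`, are
concluded only on `S` (the order-0 bound is band-slope-free and stays global).  This is what the tangent direction of a sector needs: there the slope datum
`E₁` is the TANGENCY datum, valid only on the sector's cell (F1-DESIGN §9).  The proof is p580399's, which was already pointwise in `t`.

* **`profileIncr_hasDerivAt_chain_bounds_local`** — `∃ I₁ I₂ I₃`, `HasDerivAt` links (global), `‖I‖ ≤ C₁W₀` (global), `S s → ‖I₁ s‖ ≤ 𝔅₁`, `S s → ‖I₂ s‖ ≤ 𝔅₂`,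
  `S s → ‖I₃ s‖ ≤ 𝔅₃` (data and constants as in `…FatMultiplierIncrementLine`).

Everything is proved; no definitions, no sorry.  Nothing asserts superconductivity. [cite: BenfattoGiulianiMastropietro2006, §3 (3.2)–(3.8)]
-/

noncomputable section

namespace Summit.HubbardSuperconductivity.HubbardSuperconductivity.Theorems.TorusFourierL2

set_option linter.dupNamespace false -- summit = problem name (single-conjunct summit), D-0017

open Set Literature.MathematicalPhysics.QuantumLattice Literature.MathematicalPhysics.QuantumLattice.FermiRG
open Literature.Probability.LatticeModels Literature.Analysis.Calculus
open Summit.HubbardSuperconductivity.HubbardSuperconductivity.Theorems.KLRegimeSplit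
open Summit.HubbardSuperconductivity.HubbardSuperconductivity.Theorems.KLProgrammeLegKernels

section ProfileIncrChainLocal


variable {e₀ : ℝ} (he : 0 < e₀) (n : ℕ) {d : ℝ} (hd1 : ∀ u, |deriv (bgmCutoffSq e₀) u| ≤ d)
  (hd2 : ∀ u, |iteratedDeriv 2 (bgmCutoffSq e₀) u| ≤ d) (hd3 : ∀ u, |iteratedDeriv 3 (bgmCutoffSq e₀) u| ≤ d)
  (hd4 : ∀ u, |iteratedDeriv 4 (bgmCutoffSq e₀) u| ≤ d)
  (k₀ : ℝ) {e e₁ e₂ e₃ ν ν₁ ν₂ ν₃ : ℝ → ℝ}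
  (he' : ∀ t, HasDerivAt e (e₁ t) t) (he₁ : ∀ t, HasDerivAt e₁ (e₂ t) t) (he₂ : ∀ t, HasDerivAt e₂ (e₃ t) t)
  (hν : ∀ t, HasDerivAt ν (ν₁ t) t) (hν₁ : ∀ t, HasDerivAt ν₁ (ν₂ t) t) (hν₂ : ∀ t, HasDerivAt ν₂ (ν₃ t) t)
  (S : ℝ → Prop) {E₁ E₂ E₃ P₀ P₁ P₂ P₃ : ℝ} (hE1 : 0 ≤ E₁) (hE2 : 0 ≤ E₂) (hE3 : 0 ≤ E₃)
  (hE₁ : ∀ t, S t → |e₁ t| ≤ E₁) (hE₂ : ∀ t, S t → |e₂ t| ≤ E₂) (hE₃ : ∀ t, S t → |e₃ t| ≤ E₃)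
  (hP₀ : ∀ t, |ν t| ≤ P₀) (hP₁ : ∀ t, |ν₁ t| ≤ P₁) (hP₂ : ∀ t, |ν₂ t| ≤ P₂) (hP₃ : ∀ t, |ν₃ t| ≤ P₃)

include he hd1 hd2 hd3 hd4 he' he₁ he₂ hν hν₁ hν₂ hE1 hE2 hE3 hE₁ hE₂ hE₃ hP₀ hP₁ hP₂ hP₃ in
/-- **The derivative chain of the profile increment with band data localised to `S`**: `I = I₀ → I₁ → I₂ → I₃` along the line (`HasDerivAt` links,
global), `‖I‖ ≤ C₁W₀` everywhere, and on `S` the pointwise bounds `‖I_k(s)‖ ≤ 𝔅_k` of `profileIncr_hasDerivAt_chain_bounds` (same data, band slopes only on `S`).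
[cite: BenfattoGiulianiMastropietro2006, §3 (3.2)–(3.8)] -/
theorem profileIncr_hasDerivAt_chain_bounds_local {E₀ C₁ C₂ C₃ C₄ D₁ D₂ D₃ W₀ W₁ W₂ W₃ : ℝ} (hE₀ : E₀ = klScale e₀ n + P₀)
    (hC₁ : C₁ = d * e₀ ^ 2 / klScale e₀ n ^ 2) (hC₂ : C₂ = d * e₀ ^ 4 / klScale e₀ n ^ 4) (hC₃ : C₃ = d * e₀ ^ 6 / klScale e₀ n ^ 6)
    (hC₄ : C₄ = d * e₀ ^ 8 / klScale e₀ n ^ 8)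
    (hD₁ : D₁ = 2 * E₀ * E₁) (hD₂ : D₂ = 2 * (E₁ ^ 2 + E₀ * E₂)) (hD₃ : D₃ = 2 * (3 * E₁ * E₂ + E₀ * E₃))
    (hW₀ : W₀ = P₀ * (2 * E₀ + P₀)) (hW₁ : W₁ = 2 * (E₁ * P₀ + E₀ * P₁ + P₀ * P₁))
    (hW₂ : W₂ = 2 * (E₂ * P₀ + 2 * E₁ * P₁ + E₀ * P₂ + P₁ ^ 2 + P₀ * P₂))
    (hW₃ : W₃ = 2 * (E₃ * P₀ + 3 * E₂ * P₁ + 3 * E₁ * P₂ + E₀ * P₃ + 3 * P₁ * P₂ + P₀ * P₃)) :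
    ∃ I₁ I₂ I₃ : ℝ → ℂ,
      (∀ s, HasDerivAt (fun s => ((bgmCutoffSq e₀ ((16 : ℝ) ^ n * (k₀ ^ 2 + (e s - ν s) ^ 2)) : ℝ) : ℂ) -
        ((bgmCutoffSq e₀ ((16 : ℝ) ^ n * (k₀ ^ 2 + e s ^ 2)) : ℝ) : ℂ)) (I₁ s) s) ∧
      (∀ s, HasDerivAt I₁ (I₂ s) s) ∧ (∀ s, HasDerivAt I₂ (I₃ s) s) ∧
      (∀ s, ‖((bgmCutoffSq e₀ ((16 : ℝ) ^ n * (k₀ ^ 2 + (e s - ν s) ^ 2)) : ℝ) : ℂ) -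
        ((bgmCutoffSq e₀ ((16 : ℝ) ^ n * (k₀ ^ 2 + e s ^ 2)) : ℝ) : ℂ)‖ ≤ C₁ * W₀) ∧
      (∀ s, S s → ‖I₁ s‖ ≤ C₂ * W₀ * (D₁ + W₁) + C₁ * W₁) ∧
      (∀ s, S s → ‖I₂ s‖ ≤ C₃ * W₀ * (D₁ + W₁) ^ 2 + C₂ * (W₁ * (2 * D₁ + W₁)) + (C₂ * W₀ * (D₂ + W₂) + C₁ * W₂)) ∧
      (∀ s, S s → ‖I₃ s‖ ≤ C₄ * W₀ * (D₁ + W₁) ^ 3 + C₃ * (W₁ * (3 * D₁ ^ 2 + 3 * D₁ * W₁ + W₁ ^ 2)) +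
        3 * (C₃ * W₀ * ((D₁ + W₁) * (D₂ + W₂)) + C₂ * (D₁ * W₂ + W₁ * D₂ + W₁ * W₂)) + (C₂ * W₀ * (D₃ + W₃) + C₁ * W₃)) := by
  have hΛ : 0 < klScale e₀ n := by rw [klScale]; positivity
  have hd0 : 0 ≤ d := (abs_nonneg _).trans (hd1 0)
  have hP0 : 0 ≤ P₀ := (abs_nonneg _).trans (hP₀ 0)
  have hP1 : 0 ≤ P₁ := (abs_nonneg _).trans (hP₁ 0)
  have hP2 : 0 ≤ P₂ := (abs_nonneg _).trans (hP₂ 0)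
  have hP3 : 0 ≤ P₃ := (abs_nonneg _).trans (hP₃ 0)
  have hE0 : 0 ≤ E₀ := by rw [hE₀]; positivity
  have c1 : 0 ≤ C₁ := by rw [hC₁]; positivity
  have c2 : 0 ≤ C₂ := by rw [hC₂]; positivity
  have c3 : 0 ≤ C₃ := by rw [hC₃]; positivity
  have c4 : 0 ≤ C₄ := by rw [hC₄]; positivity
  have d1 : 0 ≤ D₁ := by rw [hD₁]; positivity
  have d2 : 0 ≤ D₂ := by rw [hD₂]; positivity
  have d3 : 0 ≤ D₃ := by rw [hD₃]; positivity
  have w0 : 0 ≤ W₀ := by rw [hW₀]; positivity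
  have w1 : 0 ≤ W₁ := by rw [hW₁]; positivity
  have w2 : 0 ≤ W₂ := by rw [hW₂]; positivity
  have w3 : 0 ≤ W₃ := by rw [hW₃]; positivity
  -- the outer function and its jets
  set G : ℝ → ℝ := (fun u => bgmCutoffSq e₀ ((16 : ℝ) ^ n * u)) with hG
  set g₀ : ℝ → ℂ := fun u => ((G u : ℝ) : ℂ) with hg₀
  set g₁ : ℝ → ℂ := fun u => ((iteratedDeriv 1 G u : ℝ) : ℂ) with hg₁
  set g₂ : ℝ → ℂ := fun u => ((iteratedDeriv 2 G u : ℝ) : ℂ) with hg₂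
  set g₃ : ℝ → ℂ := fun u => ((iteratedDeriv 3 G u : ℝ) : ℂ) with hg₃
  obtain ⟨hlink, n0, n1, n2, n3, n4, i0, i1, i2, i3⟩ := scaleProfile_chain₄ he n hd1 hd2 hd3 hd4
  have hg : ∀ x, HasDerivAt g₀ (g₁ x) x := by
    intro x; have h := hlink 0 (by norm_num) x; simpa [hg₀, hg₁, hG] using h
  have hg₁' : ∀ x, HasDerivAt g₁ (g₂ x) x := fun x => hlink 1 (by norm_num) x
  have hg₂' : ∀ x, HasDerivAt g₂ (g₃ x) x := fun x => hlink 2 (by norm_num) x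
  have h₁ : ∀ x, ‖g₁ x‖ ≤ C₁ := by intro x; rw [hC₁]; exact n1 x
  have h₂ : ∀ x, ‖g₂ x‖ ≤ C₂ := by intro x; rw [hC₂]; exact n2 x
  have h₃ : ∀ x, ‖g₃ x‖ ≤ C₃ := by intro x; rw [hC₃]; exact n3 x
  have j₀ : ∀ x y, ‖g₀ (x + y) - g₀ x‖ ≤ C₁ * |y| := by
    intro x y; rw [hC₁]; have h := i0 x y; simpa [hg₀, hG] using h
  have j₁ : ∀ x y, ‖g₁ (x + y) - g₁ x‖ ≤ C₂ * |y| := by intro x y; rw [hC₂]; exact i1 x y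
  have j₂ : ∀ x y, ‖g₂ (x + y) - g₂ x‖ ≤ C₃ * |y| := by intro x y; rw [hC₃]; exact i2 x y
  have j₃ : ∀ x y, ‖g₃ (x + y) - g₃ x‖ ≤ C₄ * |y| := by intro x y; rw [hC₄]; exact i3 x y
  -- the inner curves
  set U : ℝ → ℝ := fun s => k₀ ^ 2 + e s ^ 2 with hU
  set U₁ : ℝ → ℝ := fun s => 2 * e s * e₁ s with hU₁
  set U₂ : ℝ → ℝ := fun s => 2 * (e₁ s ^ 2 + e s * e₂ s) with hU₂
  set U₃ : ℝ → ℝ := fun s => 2 * (3 * e₁ s * e₂ s + e s * e₃ s) with hU₃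
  set W : ℝ → ℝ := fun s => -(ν s * (2 * e s - ν s)) with hW
  set V₁ : ℝ → ℝ := fun s => -2 * (e₁ s * ν s + e s * ν₁ s) + 2 * ν s * ν₁ s with hV₁
  set V₂ : ℝ → ℝ := fun s => -2 * (e₂ s * ν s + 2 * e₁ s * ν₁ s + e s * ν₂ s) + 2 * (ν₁ s ^ 2 + ν s * ν₂ s) with hV₂
  set V₃ : ℝ → ℝ := fun s => -2 * (e₃ s * ν s + 3 * e₂ s * ν₁ s + 3 * e₁ s * ν₂ s + e s * ν₃ s) + 2 * (3 * ν₁ s * ν₂ s + ν s * ν₃ s) with hV₃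
  obtain ⟨hU', hU₁', hU₂', hW', hV₁', hV₂'⟩ := profileIncr_curves_hasDerivAt k₀ he' he₁ he₂ hν hν₁ hν₂
  -- the chain of the increment
  set H : ℕ → ℝ → ℂ := fun k t =>
      if k = 0 then g₀ (U t + W t) - g₀ (U t)
      else if k = 1 then g₁ (U t + W t) * ((U₁ t + V₁ t : ℝ) : ℂ) - g₁ (U t) * (U₁ t : ℂ)
      else if k = 2 then (g₂ (U t + W t) * ((U₁ t + V₁ t : ℝ) : ℂ) ^ 2 + g₁ (U t + W t) * ((U₂ t + V₂ t : ℝ) : ℂ)) -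
        (g₂ (U t) * (U₁ t : ℂ) ^ 2 + g₁ (U t) * (U₂ t : ℂ))
      else if k = 3 then (g₃ (U t + W t) * ((U₁ t + V₁ t : ℝ) : ℂ) ^ 3 + 3 * (g₂ (U t + W t) * ((U₁ t + V₁ t : ℝ) : ℂ) *
          ((U₂ t + V₂ t : ℝ) : ℂ)) + g₁ (U t + W t) * ((U₃ t + V₃ t : ℝ) : ℂ)) -
        (g₃ (U t) * (U₁ t : ℂ) ^ 3 + 3 * (g₂ (U t) * (U₁ t : ℂ) * (U₂ t : ℂ)) + g₁ (U t) * (U₃ t : ℂ))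
      else 0 with hH
  have hchain : ∀ k < 3, ∀ t, HasDerivAt (H k) (H (k + 1) t) t :=
    hasDerivAt_comp_incr_chain hg hg₁' hg₂' hU' hU₁' hU₂' hW' hV₁' hV₂'
  -- the increment as written in the statement is `H 0`
  have hI : (fun s => ((bgmCutoffSq e₀ ((16 : ℝ) ^ n * (k₀ ^ 2 + (e s - ν s) ^ 2)) : ℝ) : ℂ) -
      ((bgmCutoffSq e₀ ((16 : ℝ) ^ n * (k₀ ^ 2 + e s ^ 2)) : ℝ) : ℂ)) = H 0 := by
    funext s
    have e1 : k₀ ^ 2 + (e s - ν s) ^ 2 = U s + W s := by simp only [hU, hW]; ring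
    simp only [hH, hg₀, hG, if_true]
    rw [e1]
  -- localisation: far from the shell every jet vanishes at both arguments
  have far : ∀ s, ¬ |e s| ≤ E₀ → ∀ k, iteratedDeriv k G (U s) = 0 ∧ iteratedDeriv k G (U s + W s) = 0 := by
    intro s hs k
    rw [not_le, hE₀] at hs
    exact profileIncr_jets_eq_zero_of_far he n k₀ hP₀ hs k
  -- pointwise bounds of the members
  have B0 : ∀ s, ‖H 0 s‖ ≤ C₁ * W₀ := by
    intro s
    have h0 : H 0 s = g₀ (U s + W s) - g₀ (U s) := by simp [hH]
    rw [h0]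
    by_cases hs : |e s| ≤ E₀
    · obtain ⟨-, -, -, bW, -, -, -⟩ := profileIncr_curves_bounds (e₁ := fun _ => (0:ℝ)) (e₂ := fun _ => (0:ℝ)) (e₃ := fun _ => (0:ℝ)) (E₁ := 0) (E₂ := 0) (E₃ := 0)
        (fun _ => by simp) (fun _ => by simp) (fun _ => by simp) hP₀ hP₁ hP₂ hP₃ hs
      rw [← hW₀] at bW
      exact norm_comp_incr_le j₀ bW
    · have z1 := (far s hs 0).1; have z2 := (far s hs 0).2
      rw [iteratedDeriv_zero] at z1 z2
      have : g₀ (U s + W s) - g₀ (U s) = 0 := by simp only [hg₀, z1, z2]; simp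
      rw [this, norm_zero]; positivity
  have B1 : ∀ s, S s → ‖H 1 s‖ ≤ C₂ * W₀ * (D₁ + W₁) + C₁ * W₁ := by
    intro s hS
    have h1 : H 1 s = g₁ (U s + W s) * ((U₁ s + V₁ s : ℝ) : ℂ) - g₁ (U s) * (U₁ s : ℂ) := by simp [hH]
    rw [h1]
    by_cases hs : |e s| ≤ E₀
    · obtain ⟨bU₁, -, -, bW, bV₁, -, -⟩ := profileIncr_curves_bounds (e₁ := fun _ => e₁ s) (e₂ := fun _ => e₂ s) (e₃ := fun _ => e₃ s)
        (fun _ => hE₁ s hS) (fun _ => hE₂ s hS) (fun _ => hE₃ s hS) hP₀ hP₁ hP₂ hP₃ hs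
      rw [← hD₁] at bU₁; rw [← hW₀] at bW; rw [← hW₁] at bV₁
      exact norm_comp_incr_deriv1_le h₁ j₁ bU₁ bW bV₁
    · have z1 := (far s hs 1).1; have z2 := (far s hs 1).2
      have : g₁ (U s + W s) * ((U₁ s + V₁ s : ℝ) : ℂ) - g₁ (U s) * (U₁ s : ℂ) = 0 := by simp only [hg₁, z1, z2]; simp
      rw [this, norm_zero]; positivity
  have B2 : ∀ s, S s → ‖H 2 s‖ ≤ C₃ * W₀ * (D₁ + W₁) ^ 2 + C₂ * (W₁ * (2 * D₁ + W₁)) + (C₂ * W₀ * (D₂ + W₂) + C₁ * W₂) := by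
    intro s hS
    have h2 : H 2 s = (g₂ (U s + W s) * ((U₁ s + V₁ s : ℝ) : ℂ) ^ 2 + g₁ (U s + W s) * ((U₂ s + V₂ s : ℝ) : ℂ)) -
        (g₂ (U s) * (U₁ s : ℂ) ^ 2 + g₁ (U s) * (U₂ s : ℂ)) := by simp [hH]
    rw [h2]
    by_cases hs : |e s| ≤ E₀
    · obtain ⟨bU₁, bU₂, -, bW, bV₁, bV₂, -⟩ := profileIncr_curves_bounds (e₁ := fun _ => e₁ s) (e₂ := fun _ => e₂ s) (e₃ := fun _ => e₃ s)
        (fun _ => hE₁ s hS) (fun _ => hE₂ s hS) (fun _ => hE₃ s hS) hP₀ hP₁ hP₂ hP₃ hs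
      rw [← hD₁] at bU₁; rw [← hD₂] at bU₂; rw [← hW₀] at bW; rw [← hW₁] at bV₁; rw [← hW₂] at bV₂
      exact norm_comp_incr_deriv2_le h₁ h₂ j₁ j₂ bU₁ bU₂ bW bV₁ bV₂
    · have z1 := (far s hs 1).1; have z2 := (far s hs 1).2; have z3 := (far s hs 2).1; have z4 := (far s hs 2).2
      have : (g₂ (U s + W s) * ((U₁ s + V₁ s : ℝ) : ℂ) ^ 2 + g₁ (U s + W s) * ((U₂ s + V₂ s : ℝ) : ℂ)) -
          (g₂ (U s) * (U₁ s : ℂ) ^ 2 + g₁ (U s) * (U₂ s : ℂ)) = 0 := by simp only [hg₁, hg₂, z1, z2, z3, z4]; simp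
      rw [this, norm_zero]; positivity
  have B3 : ∀ s, S s → ‖H 3 s‖ ≤ C₄ * W₀ * (D₁ + W₁) ^ 3 + C₃ * (W₁ * (3 * D₁ ^ 2 + 3 * D₁ * W₁ + W₁ ^ 2)) +
      3 * (C₃ * W₀ * ((D₁ + W₁) * (D₂ + W₂)) + C₂ * (D₁ * W₂ + W₁ * D₂ + W₁ * W₂)) + (C₂ * W₀ * (D₃ + W₃) + C₁ * W₃) := by
    intro s hS
    have h3 : H 3 s = (g₃ (U s + W s) * ((U₁ s + V₁ s : ℝ) : ℂ) ^ 3 + 3 * (g₂ (U s + W s) * ((U₁ s + V₁ s : ℝ) : ℂ) *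
          ((U₂ s + V₂ s : ℝ) : ℂ)) + g₁ (U s + W s) * ((U₃ s + V₃ s : ℝ) : ℂ)) -
        (g₃ (U s) * (U₁ s : ℂ) ^ 3 + 3 * (g₂ (U s) * (U₁ s : ℂ) * (U₂ s : ℂ)) + g₁ (U s) * (U₃ s : ℂ)) := by simp [hH]
    rw [h3]
    by_cases hs : |e s| ≤ E₀
    · obtain ⟨bU₁, bU₂, bU₃, bW, bV₁, bV₂, bV₃⟩ := profileIncr_curves_bounds (e₁ := fun _ => e₁ s) (e₂ := fun _ => e₂ s) (e₃ := fun _ => e₃ s)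
        (fun _ => hE₁ s hS) (fun _ => hE₂ s hS) (fun _ => hE₃ s hS) hP₀ hP₁ hP₂ hP₃ hs
      rw [← hD₁] at bU₁; rw [← hD₂] at bU₂; rw [← hD₃] at bU₃; rw [← hW₀] at bW; rw [← hW₁] at bV₁; rw [← hW₂] at bV₂
      rw [← hW₃] at bV₃
      exact norm_comp_incr_deriv3_le h₁ h₂ h₃ j₁ j₂ j₃ bU₁ bU₂ bU₃ bW bV₁ bV₂ bV₃
    · have z1 := (far s hs 1).1; have z2 := (far s hs 1).2; have z3 := (far s hs 2).1; have z4 := (far s hs 2).2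
      have z5 := (far s hs 3).1; have z6 := (far s hs 3).2
      have : (g₃ (U s + W s) * ((U₁ s + V₁ s : ℝ) : ℂ) ^ 3 + 3 * (g₂ (U s + W s) * ((U₁ s + V₁ s : ℝ) : ℂ) *
          ((U₂ s + V₂ s : ℝ) : ℂ)) + g₁ (U s + W s) * ((U₃ s + V₃ s : ℝ) : ℂ)) -
          (g₃ (U s) * (U₁ s : ℂ) ^ 3 + 3 * (g₂ (U s) * (U₁ s : ℂ) * (U₂ s : ℂ)) + g₁ (U s) * (U₃ s : ℂ)) = 0 := by
        simp only [hg₁, hg₂, hg₃, z1, z2, z3, z4, z5, z6]; simp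
      rw [this, norm_zero]; positivity
  -- export the chain
  refine ⟨H 1, H 2, H 3, fun s => ?_, hchain 1 (by norm_num), hchain 2 (by norm_num), fun s => ?_, B1, B2, B3⟩
  · have h := hchain 0 (by norm_num) s
    rw [← hI] at h; exact h
  · have h := B0 s
    have e0 : H 0 s = ((bgmCutoffSq e₀ ((16 : ℝ) ^ n * (k₀ ^ 2 + (e s - ν s) ^ 2)) : ℝ) : ℂ) -
        ((bgmCutoffSq e₀ ((16 : ℝ) ^ n * (k₀ ^ 2 + e s ^ 2)) : ℝ) : ℂ) := by rw [← hI]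
    rw [e0] at h; exact h


end ProfileIncrChainLocal

end Summit.HubbardSuperconductivity.HubbardSuperconductivity.Theorems.TorusFourierL2

end
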